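import Literature.Analysis.Complex.JensenPolynomialCircleKernelDetection
import Literature.Analysis.Complex.HolomorphicParametricIntegral
import HarnessLib

/-!
# Route JensenLogBand, BAND crux (stmt-RiemannHypothesis-19913) — infrastructure for (S3):
# a zero near an approximate zero (Newton–Kantorovich via Rouché and the Schwarz remainder; RH-FREE)

Cell rh-jensen, LADDER-RH rung J-P(P3) «log band»; step (S3) «saddle existence» of the BAND lead's
LINE-PLAN asks for a zero `u*` of the model phase derivative `P_x′` near the first-order guess, by
«Newton–Kantorovich via the tree's Rouché `exists_zero_of_norm_sub_lt`». This file packages that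
tool once, for any `f` holomorphic and bounded by `M` on `ball c R`:

* `exists_zero_of_newton_rouche` — if `‖f c‖ + 4M(r/R)² < ‖f′(c)‖·r` for some `0 < r < R`, then
  `f` has a zero `u` with `‖u - c‖ < r`. Proof: the linearisation `L(z) = f(c) + f′(c)(z - c)`
  vanishes at `η₀ = c - f(c)/f′(c)`, `‖η₀ - c‖ < r`; on the circle `‖z - c‖ = r` the second-order
  Schwarz estimate (tree `norm_sub_sub_fderiv_le_of_forall_mem_ball_norm_le`) gives
  `‖f z - L z‖ ≤ 4M(r/R)² < ‖f′(c)‖r - ‖f c‖ ≤ ‖L z‖`, and Rouché (tree `exists_zero_of_norm_sub_lt`).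

WHAT THIS IS NOT: generic complex analysis; nothing here bears on zeros of `ζ` or the truth of RH.
(prover-rh-jensen-eng-2-g5-0, 2026-08-27.)
-/

noncomputable section

open Complex Metric Set

set_option linter.dupNamespace false

namespace Summit.RiemannHypothesis.RiemannHypothesis.Theorems.JensenPolynomials.LogBandArc

/-- For `f : ℂ → ℂ`, the Fréchet derivative acts by multiplication with the derivative:
`Df(c)(w) = w · f′(c)`. RH-FREE. -/
theorem fderiv_apply_eq_mul_deriv (f : ℂ → ℂ) (c w : ℂ) : fderiv ℂ f c w = w * deriv f c := by
  have h : fderiv ℂ f c w = fderiv ℂ f c (w • (1 : ℂ)) := by rw [smul_eq_mul, mul_one]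
  rw [h, ContinuousLinearMap.map_smul, fderiv_apply_one_eq_deriv, smul_eq_mul]

/-- **A zero near an approximate zero (Newton–Kantorovich via Rouché).** Let `f` be holomorphic on
`ball c R` with `‖f‖ ≤ M` there, and let `0 < r < R` with `‖f c‖ + 4M(r/R)² < ‖f′(c)‖·r`. Then `f`
has a zero in the open disc `‖u - c‖ < r`. RH-FREE. -/
theorem exists_zero_of_newton_rouche {f : ℂ → ℂ} {c : ℂ} {R r M : ℝ} (hr : 0 < r) (hrR : r < R)
    (hf : DifferentiableOn ℂ f (ball c R)) (hM : ∀ z ∈ ball c R, ‖f z‖ ≤ M)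
    (hkey : ‖f c‖ + 4 * M * (r / R) ^ 2 < ‖deriv f c‖ * r) :
    ∃ u : ℂ, ‖u - c‖ < r ∧ f u = 0 := by
  have hR : 0 < R := hr.trans hrR
  set d : ℂ := deriv f c with hd
  have hM0 : 0 ≤ M := (norm_nonneg _).trans (hM c (mem_ball_self hR))
  have hd0 : d ≠ 0 := by
    intro h0
    rw [h0, norm_zero, zero_mul] at hkey
    have : 0 ≤ ‖f c‖ + 4 * M * (r / R) ^ 2 := by positivity
    linarith
  have hdpos : 0 < ‖d‖ := norm_pos_iff.2 hd0
  -- the linearisation and its zero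
  set L : ℂ → ℂ := fun z => f c + d * (z - c) with hL
  set η₀ : ℂ := c - f c / d with hη₀
  have hLη : L η₀ = 0 := by
    simp only [hL, hη₀]
    field_simp
    ring
  have hηc : ‖η₀ - c‖ < r := by
    have e : η₀ - c = -(f c / d) := by rw [hη₀]; ring
    rw [e, norm_neg, norm_div, div_lt_iff₀ hdpos]
    have : 0 ≤ 4 * M * (r / R) ^ 2 := by positivity
    linarith
  have hLdiff : DifferentiableOn ℂ L (ball c R) := by
    simp only [hL]; fun_prop
  -- Rouché on the circle `‖z - c‖ = r`
  refine Literature.Analysis.Complex.JensenCircleKernel.exists_zero_of_norm_sub_lt hr hrR hf hLdiff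
    (fun z hz => ?_) hηc hLη
  have hzball : z ∈ ball c R := by
    rw [mem_ball, dist_eq_norm]; linarith
  have hschwarz := Literature.Analysis.Complex.norm_sub_sub_fderiv_le_of_forall_mem_ball_norm_le
    hf hM hzball
  rw [fderiv_apply_eq_mul_deriv, ← hd, hz] at hschwarz
  have e : f z - L z = f z - f c - (z - c) * d := by simp only [hL]; ring
  rw [e]
  -- lower bound for `‖L z‖` on the circle
  have hLz : ‖d‖ * r - ‖f c‖ ≤ ‖L z‖ := by
    have h1 : ‖d * (z - c)‖ = ‖d‖ * r := by rw [norm_mul, hz]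
    have h2 := norm_sub_norm_le (d * (z - c)) (-(f c))
    rw [norm_neg, h1] at h2
    have e2 : d * (z - c) - -f c = L z := by simp only [hL]; ring
    rw [e2] at h2
    linarith
  calc ‖f z - f c - (z - c) * d‖ ≤ 4 * M * (r / R) ^ 2 := hschwarz
    _ < ‖d‖ * r - ‖f c‖ := by linarith
    _ ≤ ‖L z‖ := hLz

/-- **Convenient sufficient condition:** `2‖f c‖ < ‖f′(c)‖·r` and `8 M r ≤ ‖f′(c)‖·R²`
(then `4M(r/R)² ≤ ‖f′(c)‖ r/2`), for `f` holomorphic with `‖f‖ ≤ M` on `ball c R`, `0 < r < R`,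
give a zero of `f` with `‖u - c‖ < r`. RH-FREE. -/
theorem exists_zero_of_newton_rouche' {f : ℂ → ℂ} {c : ℂ} {R r M : ℝ} (hr : 0 < r) (hrR : r < R)
    (hf : DifferentiableOn ℂ f (ball c R)) (hM : ∀ z ∈ ball c R, ‖f z‖ ≤ M)
    (h1 : 2 * ‖f c‖ < ‖deriv f c‖ * r) (h2 : 8 * M * r ≤ ‖deriv f c‖ * R ^ 2) :
    ∃ u : ℂ, ‖u - c‖ < r ∧ f u = 0 := by
  have hR : 0 < R := hr.trans hrR
  refine exists_zero_of_newton_rouche hr hrR hf hM ?_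
  have hM0 : 0 ≤ M := (norm_nonneg _).trans (hM c (mem_ball_self hR))
  -- `4M(r/R)² = (4Mr/R²)·r ≤ (‖f′c‖/2)·r`
  have e : 4 * M * (r / R) ^ 2 = (4 * M * r / R ^ 2) * r := by
    field_simp
  have h3 : 4 * M * r / R ^ 2 ≤ ‖deriv f c‖ / 2 := by
    rw [div_le_div_iff₀ (by positivity) (by norm_num : (0 : ℝ) < 2)]
    nlinarith
  rw [e]
  nlinarith [mul_le_mul_of_nonneg_right h3 hr.le]

end Summit.RiemannHypothesis.RiemannHypothesis.Theorems.JensenPolynomials.LogBandArc
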